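import Mathlib
import Summits.BirchSwinnertonDyer.BirchSwinnertonDyer.Theorems.GenusKolyvaginAtTwoPowDvdShaCardAtTwoRTNonPhantomPowBasis

/-!
# Route `GenusKolyvaginAtTwo`, crux L_T `PowDvdShaCardAtTwoRT` (stmt-BirchSwinnertonDyer-23242), LINE 18 stub L, bottom rung:
# the NON-PHANTOM lemma at every level `2^L` — (B) the layers `V_i = 1 + 2^i M₂(ℤ/2^L)`

Seat `bsd-line-gk2-p3` g22 (PROVER 3/3, cell `bsd-f1-sign2`), `--supports stmt-BirchSwinnertonDyer-23242` (helper).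
THEOREMS ONLY (no definition, no named fact, no `sorry`). BSD is not proved by any of this; neither is the crux.
File 2 of 4 (`…RTNonPhantomPowBasis` → `…RTNonPhantomPowLayers` → `…RTNonPhantomPowCore` → `…RTNonPhantomPowCoboundary`).

WHY (series `…RTNonPhantomPow*`, the ALL-LEVELS sequel of files (I)–(VII) `…RTNonPhantom*`). The bottom-rung ENGINE of LINE 18
(LEAD gk2-p1, `RelaxedCount.false_of_bottomRung_engine(_cheb)`, `hres_of_nonPhantom_pow`) feeds the full-order PAIR Čebotarev at
EVERY level `2^M`, whose separation hypothesis `hres` asks that no non-zero class of the span `⟨c(n), res_K y⟩ ≤ H¹(K, E[2^M])`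
dies on `Γ_{K(E[2^M])}` (NON-PHANTOM).  Files (I)–(VII) settled level `4`; this series proves the group-theoretic input at every
level: **for `Γ ↠ GL₂(ℤ/2^L)` the restriction `H¹(Γ/ker, (ℤ/2^L)²) → H¹(⟨u⟩, (ℤ/2^L)²)` to the cyclic group of the Tate
transvection `u = (1 1; 0 1)` is injective** (Lawson–Wuthrich 2016 §7.1/§8 compute these `H¹` to be `ℤ/2` for `L ≥ 2`; the
inertia group of an odd multiplicative prime with `ord_p Δ` odd supplies `u`, and the Kummer condition there makes Selmer
classes principal on `u`).  Phrased for an abstract group `Γ` acting on an abstract additive group `M` through a `1`-cocycle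
`φ : Γ → M` vanishing on the kernel of the action; `P₁, P₂` a pair spanning `M` freely modulo `q = 2^L`.

THIS FILE: §3 powers of the two transvections; a `2`-torsion-valued cocycle vanishing on the kernel of the action and at `u`
vanishes on every element of every layer `V_i`, `i ≥ 1` (descending induction on the layer: generators `u^{2^i}`, `ℓ^{2^i}`, the
central scalar `1 + 2^i`, `g_i = diag(1 + 2^i, 1)` and `s g_i s⁻¹` strip the parities of the four matrix entries; `V_i` acts
trivially for `i ≥ L`).

References: T. Lawson, C. Wuthrich, *Vanishing of some Galois cohomology groups for elliptic curves*, Springer Proc. Math.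
Stat. 188 (2016), §7.1 and §8; J.-P. Serre, *Abelian ℓ-adic representations* (1968), IV A.1.2 (Tate transvection);
B. H. Gross, *Kolyvagin's work on modular elliptic curves* (1991), Prop. 9.1 (the odd-`p` analogue).
-/

-- `Summit.<P>.<Sub>` repeats `BirchSwinnertonDyer` by the tree's layout convention (D-0017)
set_option linter.dupNamespace false
set_option autoImplicit false

open Summit.BirchSwinnertonDyer.BirchSwinnertonDyer.Theorems.GenusExact.NonPhantom (smul_zsmul_comm cocycle_one
  cocycle_inv cocycle_eq_of_forall_smul_eq cocycle_conj cocycle_mul_of_eq_zero_right cocycle_mul_of_eq_zero_left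
  cocycle_sub_coboundary ker_sub_coboundary smul_lincomb forall_smul_eq_of_basis forall_smul_eq_self_of_basis
  exists_eq_two_smul_of_smul_eq)

namespace Summit.BirchSwinnertonDyer.BirchSwinnertonDyer.Theorems.GenusExact.NonPhantomPow

variable {Γ : Type*} [Group Γ] {M : Type*} [AddCommGroup M] [DistribMulAction Γ M]

/-! ## §3 The layers `V_i = 1 + 2^i M₂(ℤ/2^L)`: a `2`-torsion-valued cocycle killing `u` vanishes on `V_1` -/

section Layers

variable {P₁ P₂ : M} {q : ℤ} {L : ℕ}

/-- Powers of the transvection `u`: `u^k P₁ = P₁`, `u^k P₂ = k P₁ + P₂`. [folklore] -/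
theorem pow_smul_basis_of_transvection {u : Γ} (huP₁ : u • P₁ = P₁) (huP₂ : u • P₂ = P₁ + P₂) (k : ℕ) :
    (u ^ k) • P₁ = P₁ ∧ (u ^ k) • P₂ = (k : ℤ) • P₁ + P₂ := by
  induction k with
  | zero => simp
  | succ k ih =>
    obtain ⟨ih₁, ih₂⟩ := ih
    refine ⟨by rw [pow_succ, mul_smul, huP₁, ih₁], ?_⟩
    rw [pow_succ, mul_smul, huP₂, smul_add, ih₁, ih₂, Nat.cast_succ]
    module

/-- Powers of the lower transvection `ℓ`: `ℓ^k P₁ = P₁ + k P₂`, `ℓ^k P₂ = P₂`. [folklore] -/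
theorem pow_smul_basis_of_lower_transvection {ℓ : Γ} (hℓP₁ : ℓ • P₁ = P₁ + P₂) (hℓP₂ : ℓ • P₂ = P₂) (k : ℕ) :
    (ℓ ^ k) • P₁ = P₁ + (k : ℤ) • P₂ ∧ (ℓ ^ k) • P₂ = P₂ := by
  induction k with
  | zero => simp
  | succ k ih =>
    obtain ⟨ih₁, ih₂⟩ := ih
    refine ⟨?_, by rw [pow_succ, mul_smul, hℓP₂, ih₂]⟩
    rw [pow_succ, mul_smul, hℓP₁, smul_add, ih₁, ih₂, Nat.cast_succ]
    module

/-- `(x + 2^j y) % 2 = x % 2` for `j ≥ 1`. [folklore] -/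
theorem emod_two_add_pow_mul {j : ℕ} (hj : 1 ≤ j) (x y : ℤ) : (x + 2 ^ j * y) % 2 = x % 2 := by
  obtain ⟨t, ht⟩ : ∃ t : ℤ, (2 : ℤ) ^ j * y = 2 * t :=
    ⟨2 ^ (j - 1) * y, by rw [← mul_assoc, ← pow_succ']; congr 2; omega⟩
  rw [ht, Int.add_mul_emod_self_left]

/-- **Vanishing on the layers.**  Basis data mod `q = 2^L`; `u, ℓ, s` the two transvections and the swap; for every `i`,
elements `z i` (the scalar `1 + 2^i`) and `g i` (`diag(1 + 2^i, 1)`); `φ` a cocycle vanishing on the kernel of the action,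
with `2φ = 0` and `φ u = 0`.  Then `φ v = 0` for every `v` in a layer `V_i`, `i ≥ 1`:
`v P₁ = (1 + 2^i α) P₁ + 2^i γ P₂`, `v P₂ = 2^i β P₁ + (1 + 2^i δ) P₂`.  Proof by descending induction on the layer: `φ`
kills `u^{2^i}`, `ℓ^{2^i}` (`= s u^{2^i} s⁻¹`), the central `z i`, `g i` (the conjugates `u (g i) u⁻¹`, `ℓ (g i) ℓ⁻¹` are
`g i` times an element acting as a power of `u`, resp. as `ℓ^{2^i}`, whence `φ (g i)` is fixed by `u, ℓ`), and
`s (g i) s⁻¹`; multiplying `v` by these strips the parities of `α, γ, β, δ` and lands in `V_{i+1}`; `V_i` acts trivially for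
`i ≥ L`. [cite: LawsonWuthrich2016, §7.1 and §8] -/
theorem eq_zero_of_mem_layer (hq : q = 2 ^ L) (hqM : ∀ m : M, q • m = 0)
    (hspan : ∀ m : M, ∃ a b : ℤ, m = a • P₁ + b • P₂)
    (hindep : ∀ a b : ℤ, a • P₁ + b • P₂ = 0 → q ∣ a ∧ q ∣ b)
    {u ℓ s : Γ} (huP₁ : u • P₁ = P₁) (huP₂ : u • P₂ = P₁ + P₂)
    (hℓP₁ : ℓ • P₁ = P₁ + P₂) (hℓP₂ : ℓ • P₂ = P₂) (hsP₁ : s • P₁ = P₂) (hsP₂ : s • P₂ = P₁)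
    {z g : ℕ → Γ} (hz : ∀ i, 1 ≤ i → ∀ m : M, z i • m = (1 + 2 ^ i : ℤ) • m)
    (hg₁ : ∀ i, 1 ≤ i → g i • P₁ = (1 + 2 ^ i : ℤ) • P₁) (hg₂ : ∀ i, 1 ≤ i → g i • P₂ = P₂)
    {φ : Γ → M} (hφ : ∀ a b, φ (a * b) = φ a + a • φ b)
    (hker : ∀ ρ : Γ, (∀ m : M, ρ • m = m) → φ ρ = 0) (h2φ : ∀ a, (2 : ℤ) • φ a = 0) (hφu : φ u = 0)
    {i : ℕ} (hi : 1 ≤ i) {v : Γ} {α β γ δ : ℤ}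
    (hv₁ : v • P₁ = (1 + 2 ^ i * α) • P₁ + (2 ^ i * γ) • P₂)
    (hv₂ : v • P₂ = (2 ^ i * β) • P₁ + (1 + 2 ^ i * δ) • P₂) : φ v = 0 := by
  have hqP₁ := hqM P₁
  have hqP₂ := hqM P₂
  have huiP₁ : u⁻¹ • P₁ = P₁ := by rw [inv_smul_eq_iff, huP₁]
  have huiP₂ : u⁻¹ • P₂ = P₂ - P₁ := by rw [inv_smul_eq_iff, smul_sub, huP₁, huP₂]; abel
  have hℓiP₁ : ℓ⁻¹ • P₁ = P₁ - P₂ := by rw [inv_smul_eq_iff, smul_sub, hℓP₁, hℓP₂]; abel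
  have hℓiP₂ : ℓ⁻¹ • P₂ = P₂ := by rw [inv_smul_eq_iff, hℓP₂]
  have hsiP₁ : s⁻¹ • P₁ = P₂ := by rw [inv_smul_eq_iff, hsP₂]
  have hsiP₂ : s⁻¹ • P₂ = P₁ := by rw [inv_smul_eq_iff, hsP₁]
  -- elements of a layer `j ≥ 1` fix the `2`-torsion values of `φ`
  have fixL : ∀ (j : ℕ), 1 ≤ j → ∀ (w : Γ) (α β γ δ : ℤ), w • P₁ = (1 + 2 ^ j * α) • P₁ + (2 ^ j * γ) • P₂ →
      w • P₂ = (2 ^ j * β) • P₁ + (1 + 2 ^ j * δ) • P₂ → ∀ a, w • φ a = φ a :=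
    fun j hj w α β γ δ h₁ h₂ a ↦ smul_eq_self_of_layer hqM hspan hindep hj h₁ h₂ (h2φ a)
  -- `φ` kills the powers of `u`
  have hupow : ∀ k : ℕ, φ (u ^ k) = 0 := cocycle_pow_of_eq_zero hφ hφu
  -- `φ` kills `ℓ^{2^j}` for `j ≥ 1` (`= s u^{2^j} s⁻¹`, an element of layer `j`)
  have hℓpow : ∀ j : ℕ, 1 ≤ j → φ (ℓ ^ 2 ^ j) = 0 := by
    intro j hj
    obtain ⟨hu₁, hu₂⟩ := pow_smul_basis_of_transvection huP₁ huP₂ (2 ^ j)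
    obtain ⟨hl₁, hl₂⟩ := pow_smul_basis_of_lower_transvection hℓP₁ hℓP₂ (2 ^ j)
    have hact : ∀ m : M, (ℓ ^ 2 ^ j) • m = (s * u ^ 2 ^ j * s⁻¹) • m :=
      forall_smul_eq_of_basis hspan (by rw [hl₁, mul_smul, mul_smul, hsiP₁, hu₂, smul_add, smul_zsmul_comm, hsP₁, hsP₂, add_comm])
        (by rw [hl₂, mul_smul, mul_smul, hsiP₂, hu₁, hsP₁])
    have hfix : (s * u ^ 2 ^ j * s⁻¹) • φ s = φ s := by
      refine fixL j hj _ 0 0 1 0 ?_ ?_ s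
      · rw [← hact, hl₁]; push_cast; module
      · rw [← hact, hl₂]; module
    rw [cocycle_eq_of_forall_smul_eq hφ hker hact, cocycle_conj hφ, hupow, smul_zero, add_zero, hfix, sub_self]
  -- `φ` kills the central `z j` (`j ≥ 1`)
  have hzj : ∀ j : ℕ, 1 ≤ j → φ (z j) = 0 := by
    intro j hj
    have hfix : ∀ a : Γ, a • φ (z j) = φ (z j) := by
      intro a
      have hcomm : ∀ m : M, (a * z j) • m = (z j * a) • m := fun m ↦ by
        rw [mul_smul, mul_smul, hz j hj, hz j hj, smul_zsmul_comm]
      have h := cocycle_eq_of_forall_smul_eq hφ hker hcomm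
      rw [hφ, hφ] at h
      have hzφ : z j • φ a = φ a := fixL j hj (z j) 1 0 0 1 (by rw [hz j hj]; module) (by rw [hz j hj]; module) a
      rw [hzφ, add_comm] at h
      exact add_right_cancel h
    exact eq_zero_of_fixed_transvections hspan hindep hqP₁ hqP₂ huP₁ huP₂ hℓP₁ hℓP₂ (hfix u) (hfix ℓ)
  -- `φ` kills `g j` (`j ≥ 1`)
  have hgj : ∀ j : ℕ, 1 ≤ j → φ (g j) = 0 := by
    intro j hj
    -- inverse action of `g j` on `P₂`
    have hgiP₂ : (g j)⁻¹ • P₂ = P₂ := by rw [inv_smul_eq_iff, hg₂ j hj]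
    -- (i) `u (g j) u⁻¹ = (g j) * w` with `w` acting as `u ^ k`, `k • (1 + 2^j) P₁ = 2^j P₁`-type: use `w • P₂ = P₂ - c P₁`
    -- where `c • P₁ = (g j)⁻¹ • (2^j P₁)`; we avoid computing `c` by comparing with a NEGATIVE power of `u` through `zpow`:
    -- simpler: `w := (g j)⁻¹ * u * (g j) * u⁻¹` acts as `P₁ ↦ P₁`, `P₂ ↦ P₂ - (g j)⁻¹ • (2^j • P₁)`; and
    -- `(g j)⁻¹ • P₁ = d • P₁` for some `d` (from `hspan` and `hindep`).
    obtain ⟨d, d', hd⟩ := hspan ((g j)⁻¹ • P₁)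
    have hd' : q ∣ d' := by
      have h1 : (g j) • ((g j)⁻¹ • P₁) = P₁ := smul_inv_smul _ _
      rw [hd, smul_lincomb, hg₁ j hj, hg₂ j hj, smul_smul] at h1
      have h0 : (d * (1 + 2 ^ j) - 1) • P₁ + d' • P₂ = 0 := by
        rw [show (d * (1 + 2 ^ j) - 1) • P₁ + d' • P₂ = (d * (1 + 2 ^ j)) • P₁ + d' • P₂ - P₁ by module, h1, sub_self]
      exact (hindep _ _ h0).2
    have hgiP₁ : (g j)⁻¹ • P₁ = d • P₁ := by rw [hd, zsmul_eq_zero_of_dvd hqP₂ hd', add_zero]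
    have hux : u • φ (g j) = φ (g j) := by
      -- `w` acts as a power of `u`: `w • P₁ = P₁`, `w • P₂ = P₂ + (-(2^j d)) • P₁`
      have hw₁ : ((g j)⁻¹ * u * g j * u⁻¹) • P₁ = P₁ := by
        rw [mul_smul, mul_smul, mul_smul, huiP₁, hg₁ j hj, smul_zsmul_comm, huP₁, ← hg₁ j hj, inv_smul_smul]
      have hw₂ : ((g j)⁻¹ * u * g j * u⁻¹) • P₂ = (-(2 ^ j * d)) • P₁ + P₂ := by
        rw [mul_smul, mul_smul, mul_smul, huiP₂, smul_sub, hg₁ j hj, hg₂ j hj, smul_sub, smul_zsmul_comm, huP₁, huP₂,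
          smul_sub, smul_add, smul_zsmul_comm, hgiP₁, hgiP₂]
        module
      -- the integer power `u ^ (-(2^j d))` acts the same way
      have hupowz : ∀ k : ℤ, (u ^ k) • P₁ = P₁ ∧ (u ^ k) • P₂ = k • P₁ + P₂ := by
        intro k
        rcases Int.eq_nat_or_neg k with ⟨n, rfl | rfl⟩
        · obtain ⟨h1, h2⟩ := pow_smul_basis_of_transvection huP₁ huP₂ n
          exact ⟨by rw [zpow_natCast, h1], by rw [zpow_natCast, h2]⟩
        · obtain ⟨h1, h2⟩ := pow_smul_basis_of_transvection huP₁ huP₂ n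
          refine ⟨by rw [zpow_neg, zpow_natCast, inv_smul_eq_iff, h1], ?_⟩
          rw [zpow_neg, zpow_natCast, inv_smul_eq_iff, smul_add, smul_zsmul_comm, h1, h2]
          module
      obtain ⟨hk₁, hk₂⟩ := hupowz (-(2 ^ j * d))
      have hact : ∀ m : M, ((g j)⁻¹ * u * g j * u⁻¹) • m = (u ^ (-(2 ^ j * d))) • m :=
        forall_smul_eq_of_basis hspan (by rw [hw₁, hk₁]) (by rw [hw₂, hk₂])
      have hw0 : φ ((g j)⁻¹ * u * g j * u⁻¹) = 0 := by
        rw [cocycle_eq_of_forall_smul_eq hφ hker hact]; exact cocycle_zpow_of_eq_zero hφ hφu _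
      -- `φ (u (g j) u⁻¹)` two ways
      have h1 : φ (u * g j * u⁻¹) = u • φ (g j) := by rw [cocycle_conj hφ, hφu, smul_zero, zero_add, sub_zero]
      have h2 : φ (u * g j * u⁻¹) = φ (g j) := by
        rw [show u * g j * u⁻¹ = g j * ((g j)⁻¹ * u * g j * u⁻¹) by group, cocycle_mul_of_eq_zero_right hφ hw0]
      rw [← h1, h2]
    have hℓx : ℓ • φ (g j) = φ (g j) := by
      -- `ℓ (g j) ℓ⁻¹ = (g j) * w'` with `w'` acting as `ℓ^{2^j}`
      obtain ⟨hl₁, hl₂⟩ := pow_smul_basis_of_lower_transvection hℓP₁ hℓP₂ (2 ^ j)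
      have hdP : (d * (1 + 2 ^ j)) • P₁ = P₁ := by
        have h1 : (g j) • ((g j)⁻¹ • P₁) = P₁ := smul_inv_smul _ _
        rwa [hgiP₁, smul_zsmul_comm, hg₁ j hj, smul_smul] at h1
      have hw₁ : ((g j)⁻¹ * ℓ * g j * ℓ⁻¹) • P₁ = P₁ + (2 ^ j : ℤ) • P₂ := by
        rw [mul_smul, mul_smul, mul_smul, hℓiP₁, smul_sub, hg₁ j hj, hg₂ j hj, smul_sub, smul_zsmul_comm, hℓP₁, hℓP₂,
          show (1 + 2 ^ j : ℤ) • (P₁ + P₂) - P₂ = (1 + 2 ^ j : ℤ) • P₁ + (2 ^ j : ℤ) • P₂ by module,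
          smul_add, smul_zsmul_comm, smul_zsmul_comm, hgiP₁, hgiP₂, smul_smul, mul_comm, hdP]
      have hw₂ : ((g j)⁻¹ * ℓ * g j * ℓ⁻¹) • P₂ = P₂ := by
        rw [mul_smul, mul_smul, mul_smul, hℓiP₂, hg₂ j hj, hℓP₂, hgiP₂]
      have hl₁' : (ℓ ^ 2 ^ j) • P₁ = P₁ + (2 ^ j : ℤ) • P₂ := by rw [hl₁]; push_cast; rfl
      have hact : ∀ m : M, ((g j)⁻¹ * ℓ * g j * ℓ⁻¹) • m = (ℓ ^ 2 ^ j) • m :=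
        forall_smul_eq_of_basis hspan (by rw [hw₁, hl₁']) (by rw [hw₂, hl₂])
      have hw0 : φ ((g j)⁻¹ * ℓ * g j * ℓ⁻¹) = 0 := by
        rw [cocycle_eq_of_forall_smul_eq hφ hker hact]; exact hℓpow j hj
      have hfix : (ℓ * g j * ℓ⁻¹) • φ ℓ = φ ℓ := by
        refine fixL j hj _ 1 0 1 0 ?_ ?_ ℓ
        · rw [mul_smul, mul_smul, hℓiP₁, smul_sub, hg₁ j hj, hg₂ j hj, smul_sub, smul_zsmul_comm, hℓP₁, hℓP₂]; module
        · rw [mul_smul, mul_smul, hℓiP₂, hg₂ j hj, hℓP₂]; module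
      have h1 : φ (ℓ * g j * ℓ⁻¹) = ℓ • φ (g j) := by rw [cocycle_conj hφ, hfix]; abel
      have h2 : φ (ℓ * g j * ℓ⁻¹) = φ (g j) := by
        rw [show ℓ * g j * ℓ⁻¹ = g j * ((g j)⁻¹ * ℓ * g j * ℓ⁻¹) by group, cocycle_mul_of_eq_zero_right hφ hw0]
      rw [← h1, h2]
    exact eq_zero_of_fixed_transvections hspan hindep hqP₁ hqP₂ huP₁ huP₂ hℓP₁ hℓP₂ hux hℓx
  -- `φ` kills `s (g j) s⁻¹`
  have hsgj : ∀ j : ℕ, 1 ≤ j → φ (s * g j * s⁻¹) = 0 := by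
    intro j hj
    have hfix : (s * g j * s⁻¹) • φ s = φ s := by
      refine fixL j hj _ 0 0 0 1 ?_ ?_ s
      · rw [mul_smul, mul_smul, hsiP₁, hg₂ j hj, hsP₂]; module
      · rw [mul_smul, mul_smul, hsiP₂, hg₁ j hj, smul_zsmul_comm, hsP₁]; module
    rw [cocycle_conj hφ, hgj j hj, smul_zero, add_zero, hfix, sub_self]
  -- the descending induction on the layers
  have main : ∀ (n j : ℕ), L ≤ j + n → 1 ≤ j → ∀ (w : Γ) (α β γ δ : ℤ),
      w • P₁ = (1 + 2 ^ j * α) • P₁ + (2 ^ j * γ) • P₂ → w • P₂ = (2 ^ j * β) • P₁ + (1 + 2 ^ j * δ) • P₂ → φ w = 0 := by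
    intro n
    induction n with
    | zero =>
      intro j hLj _ w α β γ δ h₁ h₂
      rw [add_zero] at hLj
      have hdvd : q ∣ 2 ^ j := by rw [hq]; exact pow_dvd_pow 2 hLj
      apply hker
      apply forall_smul_eq_self_of_basis hspan
      · rw [h₁, lincomb_congr hqP₁ hqP₂ (a' := 1) (b' := 0) (by rw [add_sub_cancel_left]; exact hdvd.mul_right α)
          (by rw [sub_zero]; exact hdvd.mul_right γ)]; module
      · rw [h₂, lincomb_congr hqP₁ hqP₂ (a' := 0) (b' := 1) (by rw [sub_zero]; exact hdvd.mul_right β)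
          (by rw [add_sub_cancel_left]; exact hdvd.mul_right δ)]; module
    | succ n ih =>
      intro j hLj hj w α β γ δ h₁ h₂
      -- the layer above
      have up : ∀ (w' : Γ) (α' β' γ' δ' : ℤ), w' • P₁ = (1 + 2 ^ j * α') • P₁ + (2 ^ j * γ') • P₂ →
          w' • P₂ = (2 ^ j * β') • P₁ + (1 + 2 ^ j * δ') • P₂ →
          α' % 2 = 0 → β' % 2 = 0 → γ' % 2 = 0 → δ' % 2 = 0 → φ w' = 0 := by
        intro w' α' β' γ' δ' h₁' h₂' hα hβ hγ hδ
        obtain ⟨a, rfl⟩ : ∃ a, α' = 2 * a := ⟨α' / 2, by omega⟩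
        obtain ⟨b, rfl⟩ : ∃ b, β' = 2 * b := ⟨β' / 2, by omega⟩
        obtain ⟨c, rfl⟩ : ∃ c, γ' = 2 * c := ⟨γ' / 2, by omega⟩
        obtain ⟨e, rfl⟩ : ∃ e, δ' = 2 * e := ⟨δ' / 2, by omega⟩
        refine ih (j + 1) (by omega) (by omega) w' a b c e ?_ ?_
        · rw [h₁']; ring_nf
        · rw [h₂']; ring_nf
      -- strip `δ` with `s (g j) s⁻¹`
      have sδ : ∀ (w' : Γ) (α' β' γ' δ' : ℤ), w' • P₁ = (1 + 2 ^ j * α') • P₁ + (2 ^ j * γ') • P₂ →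
          w' • P₂ = (2 ^ j * β') • P₁ + (1 + 2 ^ j * δ') • P₂ →
          α' % 2 = 0 → β' % 2 = 0 → γ' % 2 = 0 → φ w' = 0 := by
        intro w' α' β' γ' δ' h₁' h₂' hα hβ hγ
        rcases Int.emod_two_eq_zero_or_one δ' with hδ | hδ
        · exact up w' α' β' γ' δ' h₁' h₂' hα hβ hγ hδ
        rw [← cocycle_mul_of_eq_zero_right hφ (hsgj j hj)]
        refine up (w' * (s * g j * s⁻¹)) α' (β' + 2 ^ j * β') γ' (1 + δ' + 2 ^ j * δ') ?_ ?_ hα ?_ hγ ?_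
        · rw [mul_smul, mul_smul, mul_smul, hsiP₁, hg₂ j hj, hsP₂, h₁']
        · rw [mul_smul, mul_smul, mul_smul, hsiP₂, hg₁ j hj, smul_zsmul_comm, hsP₁, smul_zsmul_comm, h₂']; module
        · rw [emod_two_add_pow_mul hj]; omega
        · rw [emod_two_add_pow_mul hj]; omega
      -- strip `β` with `u^{2^j}`
      have sβ : ∀ (w' : Γ) (α' β' γ' δ' : ℤ), w' • P₁ = (1 + 2 ^ j * α') • P₁ + (2 ^ j * γ') • P₂ →
          w' • P₂ = (2 ^ j * β') • P₁ + (1 + 2 ^ j * δ') • P₂ → α' % 2 = 0 → γ' % 2 = 0 → φ w' = 0 := by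
        intro w' α' β' γ' δ' h₁' h₂' hα hγ
        rcases Int.emod_two_eq_zero_or_one β' with hβ | hβ
        · exact sδ w' α' β' γ' δ' h₁' h₂' hα hβ hγ
        obtain ⟨hu₁, hu₂⟩ := pow_smul_basis_of_transvection huP₁ huP₂ (2 ^ j)
        rw [← cocycle_mul_of_eq_zero_right hφ (hupow (2 ^ j))]
        refine sδ (w' * u ^ 2 ^ j) α' (1 + β' + 2 ^ j * α') γ' (δ' + 2 ^ j * γ') ?_ ?_ hα ?_ hγ
        · rw [mul_smul, hu₁, h₁']
        · rw [mul_smul, hu₂, smul_add, smul_zsmul_comm, h₁', h₂']; push_cast; module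
        · rw [emod_two_add_pow_mul hj]; omega
      -- strip `γ` with `ℓ^{2^j}`
      have sγ : ∀ (w' : Γ) (α' β' γ' δ' : ℤ), w' • P₁ = (1 + 2 ^ j * α') • P₁ + (2 ^ j * γ') • P₂ →
          w' • P₂ = (2 ^ j * β') • P₁ + (1 + 2 ^ j * δ') • P₂ → α' % 2 = 0 → φ w' = 0 := by
        intro w' α' β' γ' δ' h₁' h₂' hα
        rcases Int.emod_two_eq_zero_or_one γ' with hγ | hγ
        · exact sβ w' α' β' γ' δ' h₁' h₂' hα hγ
        obtain ⟨hl₁, hl₂⟩ := pow_smul_basis_of_lower_transvection hℓP₁ hℓP₂ (2 ^ j)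
        rw [← cocycle_mul_of_eq_zero_right hφ (hℓpow j hj)]
        refine sβ (w' * ℓ ^ 2 ^ j) (α' + 2 ^ j * β') β' (γ' + 1 + 2 ^ j * δ') δ' ?_ ?_ ?_ ?_
        · rw [mul_smul, hl₁, smul_add, smul_zsmul_comm, h₁', h₂']; push_cast; module
        · rw [mul_smul, hl₂, h₂']
        · rw [emod_two_add_pow_mul hj]; omega
        · rw [emod_two_add_pow_mul hj]; omega
      -- strip `α` with `g j`
      rcases Int.emod_two_eq_zero_or_one α with hα | hα
      · exact sγ w α β γ δ h₁ h₂ hα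
      rw [← cocycle_mul_of_eq_zero_right hφ (hgj j hj)]
      refine sγ (w * g j) (1 + α + 2 ^ j * α) β (γ + 2 ^ j * γ) δ ?_ ?_ ?_
      · rw [mul_smul, hg₁ j hj, smul_zsmul_comm, h₁]; module
      · rw [mul_smul, hg₂ j hj, h₂]
      · rw [emod_two_add_pow_mul hj]; omega
  exact main (L - i) i (by omega) hi v α β γ δ hv₁ hv₂

end Layers

end Summit.BirchSwinnertonDyer.BirchSwinnertonDyer.Theorems.GenusExact.NonPhantomPow
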